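import Literature.NumberTheory.EllipticCurves.ModularSymbolRep

/-!
# `ManinStokes` (stmt-KontsevichZagierPeriods-5277, route `HeckeMultiplicityOne`): the VALUE identity
# behind Manin's three-term relation for unimodular symbols

Support file (prover-owned, `--supports stmt-KontsevichZagierPeriods-5277`). The item asks that the
three-term relation of Manin symbols hold INSIDE Kontsevich–Zagier's calculus of moves; soundness of
the calculus then forces the corresponding identity of VALUES, which this file proves outright from the
tree's period cocycle (`EichlerShimuraPeriods`) and the unimodular symbol
`unimodularSymbol f g = ⟨g⟩_f = 2πi ∫_{g0}^{g∞} f(z) dz` of `ModularSymbolRep`: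

  `⟨g⟩_f + ⟨gR⟩_f + ⟨gR²⟩_f = 0`,  `R = TS`  (`unimodularSymbol_three_term`),

Cremona (2.1.5) / Manin 1972, (1.6): the arcs `{g0, g∞}`, `{gR0, gR∞} = {g∞, g1}`,
`{gR²0, gR²∞} = {g1, g0}` bound the ideal triangle `g·(0, ∞, 1)`. The proof is the telescoping one:
`⟨g⟩_f = 2πi (c_f(g) − c_f(gS))` (`unimodularSymbol_eq_periodFn`) where the weight-two period cocycle
`c_f(g) = ∫_τ^{i∞}(f ∣ g) − ∫_{gτ}^{i∞} f` depends only on the cusp `g∞`: `c_f(gT) = c_f(g)`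
(`periodFn_mul_T`, translation moves the base point) and `c_f(−g) = c_f(g)` (`periodFn_neg`); with the
identities `(TS)² = ST⁻¹`, `ST⁻¹S = −TST`, `S² = −1` of `SL₂(ℤ)` the six cocycle values cancel in pairs.

References: J. E. Cremona, *Algorithms for modular elliptic curves* (1997), §2.1 (2.1.4)–(2.1.6);
Ju. I. Manin, *Parabolic points and zeta functions of modular curves* (1972), §1.5–1.6;
G. Shimura, *Introduction to the arithmetic theory of automorphic functions* (1971), §8.2 (8.2.20).
No definitions, no named facts.
-/

noncomputable section

open scoped MatrixGroups ModularForm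
open CongruenceSubgroup Complex MeasureTheory Set
open UpperHalfPlane hiding I
open Literature.NumberTheory.EllipticCurves.ModularForms

namespace Summit.KontsevichZagierPeriods.HeckeMultiplicityOne.ManinStokes

variable {N : ℕ}

/-- In weight two, slashing by `T` is translation of the argument: `(φ ∣ T)(τ) = φ(τ + 1)`. [folklore] -/
theorem slash_T_apply (φ : ℍ → ℂ) (k : ℤ) (τ : ℍ) :
    (φ ∣[k] ModularGroup.T) τ = φ (ModularGroup.T • τ) := by
  rw [ModularForm.SL_slash_apply, ModularGroup.denom_apply, ModularGroup.coe_T]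
  simp

/-- `T` moves the vertical ray based at `τ` to the vertical ray based at `τ + 1`, pointwise. [folklore] -/
theorem T_smul_ofComplex_add (τ : ℍ) {t : ℝ} (ht : 0 < t) :
    ModularGroup.T • ofComplex ((τ : ℂ) + t * Complex.I) =
      ofComplex (((ModularGroup.T • τ : ℍ) : ℂ) + t * Complex.I) := by
  have hT : ∀ z : ℍ, ((ModularGroup.T • z : ℍ) : ℂ) = 1 + (z : ℂ) := fun z => by
    rw [UpperHalfPlane.modular_T_smul, UpperHalfPlane.coe_vadd]
    simp
  have h1 : 0 < ((τ : ℂ) + t * Complex.I).im := by simpa using add_pos τ.im_pos ht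
  have h2 : 0 < ((1 + (τ : ℂ)) + t * Complex.I).im := by simpa using add_pos τ.im_pos ht
  apply UpperHalfPlane.ext
  rw [hT, hT, coe_ofComplex h1, coe_ofComplex h2]
  ring

/-- **The Eichler primitive of a translate**: `∫_τ^{i∞} (φ ∣ T) = ∫_{τ+1}^{i∞} φ`. [folklore] -/
theorem eichlerPrimitive_slash_T (φ : ℍ → ℂ) (τ : ℍ) :
    eichlerPrimitive (φ ∣[(2 : ℤ)] ModularGroup.T) τ = eichlerPrimitive φ (ModularGroup.T • τ) := by
  simp only [eichlerPrimitive, slash_T_apply]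
  congr 1
  refine setIntegral_congr_fun measurableSet_Ioi fun t ht => ?_
  rw [T_smul_ofComplex_add τ ht]

/-- The weight-two period cocycle at an arbitrary base point:
`c_f(g) = ∫_τ^{i∞} (f ∣ g) − ∫_{gτ}^{i∞} f`. [cite: Shimura1971, §8.2 (8.2.20)] -/
theorem periodFn_zero_eq_at [NeZero N] (f : CuspForm (Gamma0 N) 2) (g : SL(2, ℤ)) (p : Fin 2 → ℂ)
    (τ : ℍ) : periodFn 0 f g p = eichlerPrimitive (⇑f ∣[(2 : ℤ)] g) τ - eichlerPrimitive ⇑f (g • τ) := by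
  rw [periodFn_eq f g p τ]
  simp only [eichlerKernel, Nat.cast_zero, zero_add, Finset.range_one, Finset.sum_singleton,
    Nat.choose_self, Nat.cast_one, one_mul, powPrimitive_zero, pow_zero, mul_one, Nat.sub_self]
  rfl

/-- **The period cocycle depends only on the cusp `g∞`, I**: `c_f(gT) = c_f(g)` (translation by `T`
moves the base point of the cocycle, which is base-point independent). [folklore] -/
theorem periodFn_mul_T [NeZero N] (f : CuspForm (Gamma0 N) 2) (g : SL(2, ℤ)) (p : Fin 2 → ℂ) :
    periodFn 0 f (g * ModularGroup.T) p = periodFn 0 f g p := by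
  rw [periodFn_zero_eq_at f (g * ModularGroup.T) p UpperHalfPlane.I,
    periodFn_zero_eq_at f g p (ModularGroup.T • UpperHalfPlane.I), SlashAction.slash_mul,
    eichlerPrimitive_slash_T, mul_smul]

/-- `c_f(gT⁻¹) = c_f(g)`. [folklore] -/
theorem periodFn_mul_T_inv [NeZero N] (f : CuspForm (Gamma0 N) 2) (g : SL(2, ℤ)) (p : Fin 2 → ℂ) :
    periodFn 0 f (g * ModularGroup.T⁻¹) p = periodFn 0 f g p := by
  have h := periodFn_mul_T f (g * ModularGroup.T⁻¹) p
  rw [inv_mul_cancel_right] at h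
  exact h.symm

/-- **The period cocycle depends only on the cusp `g∞`, II**: `c_f(−g) = c_f(g)` (`−1` acts trivially
in weight two). [folklore] -/
theorem periodFn_neg [NeZero N] (f : CuspForm (Gamma0 N) 2) (g : SL(2, ℤ)) (p : Fin 2 → ℂ) :
    periodFn 0 f (-g) p = periodFn 0 f g p := by
  rw [periodFn_zero_eq_at f (-g) p UpperHalfPlane.I, periodFn_zero_eq_at f g p UpperHalfPlane.I,
    slash_two_neg, ModularGroup.SL_neg_smul]

/-- `(TS)² = ST⁻¹` in `SL₂(ℤ)` (`TS = (1 −1; 1 0)` has order three in `PSL₂(ℤ)`). [folklore] -/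
theorem TS_mul_TS :
    ModularGroup.T * ModularGroup.S * (ModularGroup.T * ModularGroup.S) =
      ModularGroup.S * ModularGroup.T⁻¹ := by
  ext i j
  fin_cases i <;> fin_cases j <;>
    simp [Matrix.SpecialLinearGroup.coe_mul, ModularGroup.coe_T, ModularGroup.coe_S,
      Matrix.mul_apply, Fin.sum_univ_two]

/-- `ST⁻¹S = −TST` in `SL₂(ℤ)`. [folklore] -/
theorem S_mul_T_inv_mul_S :
    ModularGroup.S * ModularGroup.T⁻¹ * ModularGroup.S =
      -(ModularGroup.T * ModularGroup.S * ModularGroup.T) := by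
  ext i j
  fin_cases i <;> fin_cases j <;>
    simp [Matrix.SpecialLinearGroup.coe_mul, ModularGroup.coe_T, ModularGroup.coe_S,
      Matrix.mul_apply, Fin.sum_univ_two]

/-- **Manin's three-term relation for the values of unimodular symbols** (Cremona (2.1.5),
`(g) + (gTS) + (g(TS)²) = 0`; Manin 1972, §1.6): for a weight-two cusp form `f` on `Γ₀(N)` and
`g ∈ SL₂(ℤ)`, with `R = TS`,
`⟨g⟩_f + ⟨gR⟩_f + ⟨gR²⟩_f = 2πi (∫_{g0}^{g∞} + ∫_{g∞}^{g1} + ∫_{g1}^{g0}) f(z) dz = 0`.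
Telescoping proof through the period cocycle: `⟨g⟩_f = 2πi (c_f(g) − c_f(gS))` and `c_f` only depends
on the cusp `g∞` (`periodFn_mul_T`, `periodFn_neg`), while `gRS = −gT`, `gR² = gST⁻¹`,
`gR²S = −gTST`. This is the value identity that the KZ-calculus relation of item `ManinStokes`
evaluates to under `KZ.eval` (soundness check of the typed statement).
[cite: CremonaAlgorithms1997, §2.1 (2.1.5)] -/
theorem unimodularSymbol_three_term [NeZero N] (f : CuspForm (Gamma0 N) 2) (g : SL(2, ℤ)) :
    unimodularSymbol f g + unimodularSymbol f (g * (ModularGroup.T * ModularGroup.S)) +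
      unimodularSymbol f (g * (ModularGroup.T * ModularGroup.S) *
        (ModularGroup.T * ModularGroup.S)) = 0 := by
  set p : Fin 2 → ℂ := 0
  have e2 : periodFn 0 f (g * (ModularGroup.T * ModularGroup.S) * ModularGroup.S) p =
      periodFn 0 f g p := by
    rw [mul_assoc, mul_assoc, S_mul_S, mul_neg_one, mul_neg, periodFn_neg, periodFn_mul_T]
  have e3 : periodFn 0 f (g * (ModularGroup.T * ModularGroup.S) *
      (ModularGroup.T * ModularGroup.S)) p = periodFn 0 f (g * ModularGroup.S) p := by
    rw [mul_assoc g, TS_mul_TS, ← mul_assoc, periodFn_mul_T_inv]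
  have e4 : periodFn 0 f (g * (ModularGroup.T * ModularGroup.S) *
      (ModularGroup.T * ModularGroup.S) * ModularGroup.S) p =
      periodFn 0 f (g * (ModularGroup.T * ModularGroup.S)) p := by
    rw [mul_assoc g, TS_mul_TS, mul_assoc g, S_mul_T_inv_mul_S, mul_neg, periodFn_neg,
      ← mul_assoc, periodFn_mul_T]
  rw [unimodularSymbol_eq_periodFn f g p,
    unimodularSymbol_eq_periodFn f (g * (ModularGroup.T * ModularGroup.S)) p,
    unimodularSymbol_eq_periodFn f (g * (ModularGroup.T * ModularGroup.S) *
      (ModularGroup.T * ModularGroup.S)) p, e2, e3, e4]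
  ring

end Summit.KontsevichZagierPeriods.HeckeMultiplicityOne.ManinStokes
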